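import Mathlib.NumberTheory.NumberField.Basic
import Mathlib.NumberTheory.RamificationInertia.Galois
import Mathlib.RingTheory.RamificationInertia.Basic
import Mathlib.RingTheory.DedekindDomain.IntegralClosure
import HarnessLib

/-!
# Ramification indices are invariant under isomorphisms of extensions of number fields

Classical bookkeeping (Neukirch, *Algebraic Number Theory*, Ch. I §8–§9: the invariants `e`, `f` of a
prime in an extension depend only on the isomorphism class of the extension). For number fields
`F ⊆ K`, `F ⊆ L` and an `F`-algebra isomorphism `e : K ≃ₐ[F] L`, the induced isomorphism
`ε = 𝓞(e) : 𝓞 K ≃ₐ[𝓞 F] 𝓞 L` (Mathlib `NumberField.RingOfIntegers.mapAlgEquiv`) carries a nonzero prime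
`u` of `𝓞 K` to a nonzero prime `ε(u)` of `𝓞 L` with the same prime of `𝓞 F` below it and the same
ramification indices `e(ε(u) | ε(u) ∩ 𝓞 F) = e(u | u ∩ 𝓞 F)` and `e(ε(u) | p) = e(u | p)`. This lets
results proved for subfields of a FIXED algebraic closure (where absolute inertia groups live) be read
on an abstractly given extension field. Theorems only; no definitions, no named facts.

## References

* [NeukirchANT1999] J. Neukirch, *Algebraic Number Theory*, Springer (1999), Ch. I §8 (8.2), §9 (9.1).
-/

noncomputable section

namespace Literature.NumberTheory.NumberFields

open NumberField IsDedekindDomain Ideal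

universe u v w

variable {F : Type u} {K : Type v} {L : Type w} [Field F] [NumberField F] [Field K] [NumberField K]
  [Field L] [NumberField L] [Algebra F K] [Algebra F L]

omit [NumberField F] [NumberField K] [NumberField L] in
/-- The image of an ideal of `𝓞 K` under the isomorphism `𝓞 K ≃ 𝓞 L` induced by `e : K ≃ₐ[F] L` has the
same contraction to `𝓞 F` (`ε` commutes with the structure maps from `𝓞 F`).
[cite: NeukirchANT1999, Ch. I §8 (8.2)] -/
theorem under_map_mapAlgEquiv (e : K ≃ₐ[F] L) (I : Ideal (𝓞 K)) :
    (I.map (RingOfIntegers.mapAlgEquiv e : 𝓞 K ≃ₐ[𝓞 F] 𝓞 L)).under (𝓞 F) = I.under (𝓞 F) := by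
  set ε : 𝓞 K ≃ₐ[𝓞 F] 𝓞 L := RingOfIntegers.mapAlgEquiv e with hε
  have h1 : I.map ε = I.comap ((ε : 𝓞 K ≃+* 𝓞 L).symm : 𝓞 L →+* 𝓞 K) := by
    change I.map (ε : 𝓞 K ≃+* 𝓞 L) = _
    exact (Ideal.comap_symm (ε : 𝓞 K ≃+* 𝓞 L)).symm
  rw [Ideal.under_def, Ideal.under_def, h1, Ideal.comap_comap]
  congr 1
  ext x
  simp only [RingHom.coe_comp, Function.comp_apply]
  exact congrArg Subtype.val (ε.symm.commutes x)

omit [NumberField F] [NumberField K] [NumberField L] in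
/-- The same over `ℤ`: `ε(u) ∩ ℤ = u ∩ ℤ`. [cite: NeukirchANT1999, Ch. I §8 (8.2)] -/
theorem under_int_map_mapAlgEquiv (e : K ≃ₐ[F] L) (I : Ideal (𝓞 K)) :
    (I.map (RingOfIntegers.mapAlgEquiv e : 𝓞 K ≃ₐ[𝓞 F] 𝓞 L)).under ℤ = I.under ℤ := by
  set ε : 𝓞 K ≃ₐ[𝓞 F] 𝓞 L := RingOfIntegers.mapAlgEquiv e with hε
  have h1 : I.map ε = I.comap ((ε : 𝓞 K ≃+* 𝓞 L).symm : 𝓞 L →+* 𝓞 K) := by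
    change I.map (ε : 𝓞 K ≃+* 𝓞 L) = _
    exact (Ideal.comap_symm (ε : 𝓞 K ≃+* 𝓞 L)).symm
  rw [Ideal.under_def, Ideal.under_def, h1, Ideal.comap_comap]
  congr 1
  ext x
  simp

omit [NumberField F] [NumberField K] [NumberField L] in
/-- The image of a nonzero prime of `𝓞 K` under `𝓞 K ≃ 𝓞 L` is prime. [cite: NeukirchANT1999, Ch. I §8 (8.2)] -/
theorem isPrime_map_mapAlgEquiv (e : K ≃ₐ[F] L) (u : HeightOneSpectrum (𝓞 K)) :
    (u.asIdeal.map (RingOfIntegers.mapAlgEquiv e : 𝓞 K ≃ₐ[𝓞 F] 𝓞 L)).IsPrime :=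
  Ideal.map_isPrime_of_equiv (RingOfIntegers.mapAlgEquiv e : 𝓞 K ≃ₐ[𝓞 F] 𝓞 L)

omit [NumberField F] [NumberField K] [NumberField L] in
/-- The image of a nonzero prime of `𝓞 K` under `𝓞 K ≃ 𝓞 L` is nonzero. [cite: NeukirchANT1999, Ch. I §8 (8.2)] -/
theorem map_mapAlgEquiv_ne_bot (e : K ≃ₐ[F] L) (u : HeightOneSpectrum (𝓞 K)) :
    u.asIdeal.map (RingOfIntegers.mapAlgEquiv e : 𝓞 K ≃ₐ[𝓞 F] 𝓞 L) ≠ ⊥ := by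
  intro h
  apply u.ne_bot
  rwa [Ideal.map_eq_bot_iff_of_injective
    (EquivLike.injective (RingOfIntegers.mapAlgEquiv e : 𝓞 K ≃ₐ[𝓞 F] 𝓞 L))] at h

omit [NumberField F] [NumberField K] [NumberField L] in
/-- The image prime lies over the same prime of `𝓞 F` as `u`. [cite: NeukirchANT1999, Ch. I §8 (8.2)] -/
theorem liesOver_map_mapAlgEquiv (e : K ≃ₐ[F] L) (u : HeightOneSpectrum (𝓞 K))
    (v : Ideal (𝓞 F)) [h : u.asIdeal.LiesOver v] :
    (u.asIdeal.map (RingOfIntegers.mapAlgEquiv e : 𝓞 K ≃ₐ[𝓞 F] 𝓞 L)).LiesOver v := by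
  constructor
  rw [Ideal.LiesOver.over (P := u.asIdeal) (p := v)]
  exact (under_map_mapAlgEquiv e u.asIdeal).symm

omit [NumberField F] in
/-- **Invariance of the relative ramification index**: `e(ε(u) | 𝓞 F) = e(u | 𝓞 F)` for the prime
`ε(u)` of `𝓞 L` corresponding to the prime `u` of `𝓞 K` under `e : K ≃ₐ[F] L`.
[cite: NeukirchANT1999, Ch. I §8 (8.2)] -/
theorem ramificationIdx_map_mapAlgEquiv (e : K ≃ₐ[F] L) (u : HeightOneSpectrum (𝓞 K)) :
    (u.asIdeal.map (RingOfIntegers.mapAlgEquiv e : 𝓞 K ≃ₐ[𝓞 F] 𝓞 L)).ramificationIdx (𝓞 F) =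
      u.asIdeal.ramificationIdx (𝓞 F) := by
  set ε : 𝓞 K ≃ₐ[𝓞 F] 𝓞 L := RingOfIntegers.mapAlgEquiv e with hε
  set v : Ideal (𝓞 F) := u.asIdeal.under (𝓞 F) with hv
  haveI : u.asIdeal.LiesOver v := ⟨rfl⟩
  haveI : (u.asIdeal.map ε).LiesOver v := liesOver_map_mapAlgEquiv e u v
  haveI : (u.asIdeal.map ε).IsPrime := isPrime_map_mapAlgEquiv e u
  haveI := u.isPrime
  have hv0 : v ≠ ⊥ := fun h => u.ne_bot (Ideal.eq_bot_of_comap_eq_bot h)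
  have h1 := Ideal.ramificationIdx'_eq_ramificationIdx v (u.asIdeal.map ε) hv0
  have h2 := Ideal.ramificationIdx'_eq_ramificationIdx v u.asIdeal hv0
  rw [← h1, ← h2]
  exact Ideal.ramificationIdx'_map_eq v u.asIdeal ε

omit [NumberField F] in
/-- **Invariance of the absolute ramification index**: `e(ε(u) | p) = e(u | p)`.
[cite: NeukirchANT1999, Ch. I §8 (8.2)] -/
theorem ramificationIdx_int_map_mapAlgEquiv (e : K ≃ₐ[F] L) (u : HeightOneSpectrum (𝓞 K)) :
    (u.asIdeal.map (RingOfIntegers.mapAlgEquiv e : 𝓞 K ≃ₐ[𝓞 F] 𝓞 L)).ramificationIdx ℤ =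
      u.asIdeal.ramificationIdx ℤ := by
  set ε : 𝓞 K ≃ₐ[𝓞 F] 𝓞 L := RingOfIntegers.mapAlgEquiv e with hε
  set p : Ideal ℤ := u.asIdeal.under ℤ with hp
  haveI : u.asIdeal.LiesOver p := ⟨rfl⟩
  haveI : (u.asIdeal.map ε).IsPrime := isPrime_map_mapAlgEquiv e u
  haveI := u.isPrime
  haveI : (u.asIdeal.map ε).LiesOver p := ⟨(under_int_map_mapAlgEquiv e u.asIdeal).symm⟩
  have hp0 : p ≠ ⊥ := fun h => u.ne_bot (Ideal.eq_bot_of_comap_eq_bot h)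
  have h1 := Ideal.ramificationIdx'_eq_ramificationIdx p (u.asIdeal.map ε) hp0
  have h2 := Ideal.ramificationIdx'_eq_ramificationIdx p u.asIdeal hp0
  rw [← h1, ← h2]
  -- `ε` as a `ℤ`-algebra isomorphism
  let εℤ : 𝓞 K ≃ₐ[ℤ] 𝓞 L := AlgEquiv.ofRingEquiv (f := (ε : 𝓞 K ≃+* 𝓞 L)) (fun x => by simp)
  exact Ideal.ramificationIdx'_map_eq p u.asIdeal εℤ

end Literature.NumberTheory.NumberFields

end
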